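import Mathlib
import Summits.KontsevichZagierPeriods.Zeta5Search.BigPrimeMinors
import HarnessLib

/-!
# ζ(5) search — the four OBSERVED valuation laws (CV), (WV), (QV), (P̂V) are THEOREMS at every prime `p > b₀`

Cell `pub-zeta5` (HONEST FRAMING: systematic search; no irrationality claim unless certified), typer seat
generation 7.  `Zeta5Search/CasoratianValuation.lean` records gen-2 g5's four laws for the canonical coefficients
`U, W, V` of `F̃₇(b)` as OBSERVED `@[conjecture]`s (all primes `p ≥ 5`, with pair-floor terms
`Σ_{i<k} ⌊(b₀−b_i−b_k)/p⌋`).  This file proves each of them AT EVERY PRIME `p ≥ max(5, b₀ + 1)` — i.e. exactly the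
range in which the pair floors and the "top partners" vanish — by splitting at the Bailey excess:
inside the window (`p ≤ d(b)+1` for `W`, `p ≤ d(b)` for the minors) the big-prime divisibility theorem (W∞)
(`BigPrimeDivisibility.lean`, gen-2 g5 / typer g7) gives the required unit, and beyond it the refund is `0` and the
laws reduce to the `p`-integrality of `U, W, V` (`BigPrime.padicNorm_coeff_le_one`).  What remains OBSERVED is
precisely the range `5 ≤ p ≤ b₀`, where the blocks of `M_b` wrap around modulo `p` and the pair floors are non-zero.

* `zeta3CoefficientValuationLaw_above` — (WV) for `p ≥ max(5, b₀+1)`;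
* `casoratianValuationLaw_above`, `qMinorValuationLaw_above` — (CV), (QV) for `p ≥ max(5, b₀+1)`;
* `phatMinorValuationLaw_above` — (P̂V) for every prime `p ≥ b₀+1` (pure integrality: its refund is `≤ 0` there).
-/

noncomputable section

open Finset

namespace Summit.KontsevichZagierPeriods.Zeta5Search.BigPrime

open Summit.KontsevichZagierPeriods.Zeta5Search.DualSeries (InBox)
open Summit.KontsevichZagierPeriods.Zeta5Search.WedgeDictionary (coeffU coeffW coeffV dOf)
open Summit.KontsevichZagierPeriods.Zeta5Search.CasoratianValuation (InPolytope shift casoratian minorQ minorPhat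
  refund refundW pairFloors bMin topPartners)

section

variable {p : ℕ} [hp : Fact p.Prime]

/-- `‖x‖_p ≤ 1` and `x ≠ 0` ⟹ `v_p(x) ≥ 0`. -/
theorem padicValRat_nonneg_of_padicNorm_le_one {x : ℚ} (hx : x ≠ 0) (h : padicNorm p x ≤ 1) :
    0 ≤ padicValRat p x := by
  rw [padicNorm.eq_zpow_of_nonzero hx, ← zpow_zero (p : ℚ)] at h
  have hp1 : 1 < (p : ℚ) := by exact_mod_cast hp.out.one_lt
  have := (zpow_le_zpow_iff_right₀ hp1).1 h
  omega

/-- `p`-integrality of all six coefficients `U, W, V` at `b` and at `b + e_j`, for `p > b₀`. -/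
theorem norms_le_one (b : ℕ → ℤ) (j : ℕ) (hb : InPolytope b) (hj : 1 ≤ j) (hb' : InPolytope (shift b j))
    (hpb : b 0 + 1 ≤ (p : ℤ)) :
    padicNorm p (coeffU b) ≤ 1 ∧ padicNorm p (coeffW b) ≤ 1 ∧ padicNorm p (coeffV b) ≤ 1 ∧
    padicNorm p (coeffU (shift b j)) ≤ 1 ∧ padicNorm p (coeffW (shift b j)) ≤ 1 ∧
    padicNorm p (coeffV (shift b j)) ≤ 1 := by
  obtain ⟨hbox, hhalf, hsum⟩ := polytope_hyps b hb
  obtain ⟨hbox', hhalf', hsum'⟩ := polytope_hyps _ hb'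
  have h0 : 0 ≤ b 0 := hbox.1
  have hnp : (b 0).toNat < p := by omega
  have hnp' : (shift b j 0).toNat < p := by rw [shift_zero b hj]; exact hnp
  obtain ⟨hU, hW, hV⟩ := padicNorm_coeff_le_one (p := p) b hbox hhalf hsum hnp
  obtain ⟨hU', hW', hV'⟩ := padicNorm_coeff_le_one (p := p) _ hbox' hhalf' hsum' hnp'
  exact ⟨hU, hW, hV, hU', hW', hV'⟩

end

/-! ### The law parameters above `b₀` -/

/-- Above `b₀` there are no "top partners": `a_p(b) = 0` for `p ≥ b₀ + 1`. -/
theorem topPartners_eq_zero (b : ℕ → ℤ) (hb : InPolytope b) {p : ℕ} (hpb : b 0 + 1 ≤ (p : ℤ)) :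
    topPartners b p = 0 := by
  have hmin : 0 ≤ bMin b := by
    have hmem := Finset.min'_mem ((range 7).image fun i => b (i + 1)) (by simp)
    obtain ⟨i, hi, hieq⟩ := mem_image.1 hmem
    have := (hb.1.2 i hi).1
    rw [bMin, ← hieq]; exact this
  have hfilter : ((range 7).filter fun i => (p : ℤ) ≤ b 0 - b (i + 1) - bMin b) = ∅ := by
    refine filter_eq_empty_iff.2 fun i hi h => ?_
    have := (hb.1.2 i hi).1
    omega
  rw [topPartners, hfilter, card_empty, if_neg (by omega)]
  simp

/-- Beyond the excess the refund vanishes: `refund b p = 0` for `p > d(b)` (`d(b) ≥ 0`). -/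
theorem refund_eq_zero (b : ℕ → ℤ) (hb : InPolytope b) {p : ℕ} (hpd : dOf b < (p : ℤ)) : refund b p = 0 := by
  have hd : 0 ≤ dOf b := by have := hb.2.2; rw [dOf]; omega
  rw [refund, Int.ediv_eq_zero_of_lt hd hpd, min_eq_right (by norm_num)]

/-- `refundW b p = 1` for `0 < p ≤ d(b) + 1`. -/
theorem refundW_eq_one (b : ℕ → ℤ) {p : ℕ} (hp : 0 < p) (hpd : (p : ℤ) ≤ dOf b + 1) : refundW b p = 1 := by
  rw [refundW, min_eq_left_iff]
  exact (Int.le_ediv_iff_mul_le (by exact_mod_cast hp)).2 (by simpa using hpd)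

/-- `refundW b p = 0` for `p > d(b) + 1` (`d(b) ≥ 0`). -/
theorem refundW_eq_zero (b : ℕ → ℤ) (hb : InPolytope b) {p : ℕ} (hpd : dOf b + 1 < (p : ℤ)) :
    refundW b p = 0 := by
  have hd : 0 ≤ dOf b := by have := hb.2.2; rw [dOf]; omega
  rw [refundW, Int.ediv_eq_zero_of_lt (by omega) hpd, min_eq_right (by norm_num)]

/-! ### The four laws above `b₀` -/

/-- **(WV) holds at every prime `p ≥ max(5, b₀+1)`.** -/
theorem zeta3CoefficientValuationLaw_above (b : ℕ → ℤ) (p : ℕ) (hb : InPolytope b) (hprime : p.Prime)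
    (hp5 : 5 ≤ p) (hpb : b 0 + 1 ≤ (p : ℤ)) (hW : coeffW b ≠ 0) :
    refundW b p + topPartners b p - pairFloors b p ≤ padicValRat p (coeffW b) := by
  haveI : Fact p.Prime := ⟨hprime⟩
  rw [topPartners_eq_zero b hb hpb, pairFloors_eq_zero b hb hpb, add_zero, sub_zero]
  rcases le_or_gt (p : ℤ) (dOf b + 1) with hin | hout
  · rw [refundW_eq_one b hprime.pos hin]
    exact one_le_padicValRat_coeffW b p hb.1 hb.2.1 hb.2.2 hprime hp5 hpb hin hW
  · rw [refundW_eq_zero b hb hout]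
    obtain ⟨hbox, hhalf, hsum⟩ := polytope_hyps b hb
    have h0 : 0 ≤ b 0 := hbox.1
    obtain ⟨-, hWn, -⟩ := padicNorm_coeff_le_one (p := p) b hbox hhalf hsum (by omega)
    exact padicValRat_nonneg_of_padicNorm_le_one hW hWn

/-- **(CV) holds at every prime `p ≥ max(5, b₀+1)`.** -/
theorem casoratianValuationLaw_above (b : ℕ → ℤ) (j p : ℕ) (hb : InPolytope b) (hj : 1 ≤ j) (hj' : j ≤ 7)
    (hb' : InPolytope (shift b j)) (hprime : p.Prime) (hp5 : 5 ≤ p) (hpb : b 0 + 1 ≤ (p : ℤ))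
    (hne : casoratian b j ≠ 0) : refund b p - pairFloors b p ≤ padicValRat p (casoratian b j) := by
  haveI : Fact p.Prime := ⟨hprime⟩
  rcases le_or_gt (p : ℤ) (dOf b) with hin | hout
  · exact casoratianValuationLaw_bigPrime b j p hb hj hj' hb' hprime hp5 hpb hin hne
  · rw [refund_eq_zero b hb hout, pairFloors_eq_zero b hb hpb, sub_zero]
    obtain ⟨-, hW, hV, -, hW', hV'⟩ := norms_le_one (p := p) b j hb hj hb' hpb
    refine padicValRat_nonneg_of_padicNorm_le_one hne ?_
    rw [casoratian]
    exact padicNorm.sub.trans (max_le (padicNorm_mul_le_one hW' hV) (padicNorm_mul_le_one hW hV'))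

/-- **(QV) holds at every prime `p ≥ max(5, b₀+1)`.** -/
theorem qMinorValuationLaw_above (b : ℕ → ℤ) (j p : ℕ) (hb : InPolytope b) (hj : 1 ≤ j) (hj' : j ≤ 7)
    (hb' : InPolytope (shift b j)) (hprime : p.Prime) (hp5 : 5 ≤ p) (hpb : b 0 + 1 ≤ (p : ℤ))
    (hne : minorQ b j ≠ 0) : refund b p - pairFloors b p ≤ padicValRat p (minorQ b j) := by
  haveI : Fact p.Prime := ⟨hprime⟩
  rcases le_or_gt (p : ℤ) (dOf b) with hin | hout
  · exact qMinorValuationLaw_bigPrime b j p hb hj hj' hb' hprime hp5 hpb hin hne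
  · rw [refund_eq_zero b hb hout, pairFloors_eq_zero b hb hpb, sub_zero]
    obtain ⟨hU, hW, -, hU', hW', -⟩ := norms_le_one (p := p) b j hb hj hb' hpb
    refine padicValRat_nonneg_of_padicNorm_le_one hne ?_
    rw [minorQ]
    exact padicNorm.sub.trans (max_le (padicNorm_mul_le_one hU hW') (padicNorm_mul_le_one hU' hW))

/-- **(P̂V) holds at every prime `p ≥ b₀+1`** (there its left-hand side is `≤ 0`: pure `p`-integrality of `U, V`). -/
theorem phatMinorValuationLaw_above (b : ℕ → ℤ) (j p : ℕ) (hb : InPolytope b) (hj : 1 ≤ j)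
    (hb' : InPolytope (shift b j)) (hprime : p.Prime) (hpb : b 0 + 1 ≤ (p : ℤ)) (hne : minorPhat b j ≠ 0) :
    refund b p - 1 - pairFloors b p ≤ padicValRat p (minorPhat b j) := by
  haveI : Fact p.Prime := ⟨hprime⟩
  rw [pairFloors_eq_zero b hb hpb, sub_zero]
  obtain ⟨hU, -, hV, hU', -, hV'⟩ := norms_le_one (p := p) b j hb hj hb' hpb
  have h0 : 0 ≤ padicValRat p (minorPhat b j) := by
    refine padicValRat_nonneg_of_padicNorm_le_one hne ?_
    rw [minorPhat]
    exact padicNorm.sub.trans (max_le (padicNorm_mul_le_one hU hV') (padicNorm_mul_le_one hU' hV))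
  have h1 : refund b p ≤ 1 := min_le_left _ _
  omega

end Summit.KontsevichZagierPeriods.Zeta5Search.BigPrime

end
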